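import Summits.BirchSwinnertonDyer.Rank1Residual.X12.InertCoreManinFree
import Literature.NumberTheory.EllipticCurves.DeuringSupersingularReductionHoldsProofs
import HarnessLib

/-!
# X12 inert-bad core at `p ≥ 11`, strong curve: the Manin-free class theorems WITHOUT the
# Deuring binder

HONEST FRAMING (cell `b2b-bsdres`, run/shared/lean/b2b/bsd-rank1-residual/, verbatim in every
file): the goal of the cell is to DELETE the COMBINATION-SHAPED residual classes of the
Birch–Swinnerton-Dyer formula for ALL analytic-rank `≤ 1` elliptic curves over `ℚ` — "full BSD
formula for every rank `≤ 1` curve in class `C`" assembled STRICTLY from published theorems — so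
that the rank-`≤ 1` remainder becomes exactly the CONSTRUCTION-SHAPED classes, which are TYPED
(missing-input `Prop`s), NOT attempted. This is not "finishing BSD". Class X12 (RESIDUAL-CASES §a.2:
`cm ∧ r = 1 ∧ (p = 2 ∨ (p ∣ N ∧ p not split in K))`) is CONSTRUCTION-SHAPED and stays so; this
file is bookkeeping by the off-peak literature seat `b2b-bsdres-lit-bst` (gen 11) on research-route
records of the unit `b2b-bsdres-x1b`; no claim beyond the stated class; nothing here is booked.

WHAT THIS FILE DOES. `X12/InertCoreManinFree.lean` (x1b gen 16) proves the class-level upper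
half of `BSD(E,p)`, its corollaries and the STEP-L equivalences on the X12 inert-bad core at
`p ≥ 11` for the strong curve, from PUBLISHED named facts; one of its binders,
`hDeu : deuring_not_hasUnitRootAt_of_hasCM_of_not_cmSplit` (Deuring's criterion, supersingular
half, over every number field: a CM curve `E/ℚ` has no unit root at any good place above a prime
that does not split in the CM field), is no longer a hypothesis of the tree but a THEOREM:
`Literature.NumberTheory.EllipticCurves.deuring_not_hasUnitRootAt_of_hasCM_of_not_cmSplit_holds`
(`Literature/NumberTheory/EllipticCurves/DeuringSupersingularReductionHoldsProofs.lean`, p253190;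
route: `j(Ẽ_w) = j(E) mod w`, supersingularity over a finite field depends on `(j̃, p)`, comparison
with globally minimal CM models over `ℚ`). This file re-issues the eight theorems of that file
WITHOUT the binder (primed names, statements otherwise byte-identical, each proof = the original
applied to the `_holds` theorem); the originals stay for their importers (append-only rule; the
400-line rule forbids appending there). After this file the class-level sentences of the inert
core at `p ≥ 11` for the strong curve bind ONLY: Gross–Zagier, Kolyvagin, Matar–Nekovář 2019
Thm. 0.3, GZK, modularity (`hmod`, `hnf`), Friedberg–Hoffstein, the rank-0 CM triple (Rubin 1991 +
Burungale–Flach 2024), Edixhoven 1991 Thm. 3 (`hEdx`), and — in §3 — Cassels' isogeny invariance.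
Companion file: `X12/InertCoreEveryCurveDeuringFree.lean` (the every-curve forms of x1b gen 19).

References: S. Lang, *Elliptic Functions* (GTM 112, 1987) Ch. 13 §4 Thm. 12 [Lang1987];
M. Deuring, Abh. Math. Sem. Hamburg 14 (1941) 197–272 [Deuring1941]; B. Edixhoven, Progr. Math. 89
(1991) 25–39, Thm. 3 [EdixhovenManin1991]; A. Matar, J. Nekovář, JTNB 31 (2019) Thm. 0.3, §0.11
[MatarNekovar2019]; HOME `b2b-bsdres-lit-bst/BST-BCST.md` §14.6 (the discharge) and §15 (this file);
HOME `b2b-bsdres-x1b/X12-ROUTE.md` §20, §23 (the originals).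
-/

noncomputable section

open scoped Classical NumberField

open WeierstrassCurve NumberField IsDedekindDomain Literature.NumberTheory.EllipticCurves
  Literature.NumberTheory.EllipticCurves.ModularForms
  Literature.NumberTheory.EllipticCurves.Rank1Residual
  Literature.NumberTheory.EllipticCurves.Rank1Residual.Typed
  Literature.NumberTheory.Automorphic

namespace Summit.BirchSwinnertonDyer.Rank1Residual.X12

/-- **`hDeu`-free form of `not_potentiallyGoodOrdinary_of_hasCM_of_not_cmSplit`** — the same
statement with the binder `(hDeu : deuring_not_hasUnitRootAt_of_hasCM_of_not_cmSplit)` REMOVED: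
Deuring's criterion (supersingular half) is the tree theorem
`deuring_not_hasUnitRootAt_of_hasCM_of_not_cmSplit_holds` (p253190); proof = the original applied to
it. [cite: Lang1987, Ch. 13 §4 Thm. 12] -/
theorem not_potentiallyGoodOrdinary_of_hasCM_of_not_cmSplit'
    (W : WeierstrassCurve ℚ) [W.IsElliptic] (hCM : W.HasCM) (p : ℕ) [Fact p.Prime]
    (hns : ¬ CMSplit W p) :
    ¬ ∃ (L : Type) (_ : Field L) (_ : NumberField L) (_ : IsCyclotomicExtension {p} ℚ L)
        (F : IntermediateField ℚ L),
        ∀ w : HeightOneSpectrum (𝓞 F), (p : 𝓞 F) ∈ w.asIdeal →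
          (W.baseChange F).HasGoodReductionAt w ∧ (W.baseChange F).HasUnitRootAt w :=
  not_potentiallyGoodOrdinary_of_hasCM_of_not_cmSplit
    deuring_not_hasUnitRootAt_of_hasCM_of_not_cmSplit_holds W hCM p hns

/-- **`hDeu`-free form of `not_dvd_maninConstant_of_hasCM_of_not_cmSplit_of_optimal`** — the same
statement with the binder `(hDeu : deuring_not_hasUnitRootAt_of_hasCM_of_not_cmSplit)` REMOVED:
Deuring's criterion (supersingular half) is the tree theorem
`deuring_not_hasUnitRootAt_of_hasCM_of_not_cmSplit_holds` (p253190); proof = the original applied to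
it. [cite: EdixhovenManin1991, Thm. 3] [cite: Lang1987, Ch. 13 §4 Thm. 12] -/
theorem not_dvd_maninConstant_of_hasCM_of_not_cmSplit_of_optimal'
    (hEdx : edixhoven_not_dvd_maninConstant_of_not_potentiallyGoodOrdinary)
    (W : WeierstrassCurve ℚ) [W.IsElliptic] [W.IsGloballyMinimal] [NeZero (W.conductorNorm ℤ)]
    (p : ℕ) [Fact p.Prime] (hCM : W.HasCM) (hp7 : 7 < p) (hns : ¬ CMSplit W p)
    (D : ModularParametrizationData W (W.conductorNorm ℤ))
    (hopt : ∀ z ∈ D.L.lattice, ∃ w ∈ periodLattice D.f, z = D.c * w) :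
    ¬ (p : ℤ) ∣ D.c :=
  not_dvd_maninConstant_of_hasCM_of_not_cmSplit_of_optimal hEdx
    deuring_not_hasUnitRootAt_of_hasCM_of_not_cmSplit_holds W p hCM hp7 hns D hopt

/-- **`hDeu`-free form of `missingUpperBoundAt_of_classX12_of_cmInert_of_optimal`** — the same
statement with the binder `(hDeu : deuring_not_hasUnitRootAt_of_hasCM_of_not_cmSplit)` REMOVED:
Deuring's criterion (supersingular half) is the tree theorem
`deuring_not_hasUnitRootAt_of_hasCM_of_not_cmSplit_holds` (p253190); proof = the original applied to
it. [cite: EdixhovenManin1991, Thm. 3] [cite: MatarNekovar2019, Thm. 0.3 and §0.11]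
[cite: BurungaleFlach2024, Thm. 1.1 and Cor. 2] [cite: Lang1987, Ch. 13 §4 Thm. 12] -/
theorem missingUpperBoundAt_of_classX12_of_cmInert_of_optimal'
    (hGZ : ∀ (N : ℕ) [NeZero N] (W : WeierstrassCurve ℚ) (K : Type) [Field K] [NumberField K],
      gross_zagier N W K)
    (hKo : ∀ (N : ℕ) [NeZero N] (W : WeierstrassCurve ℚ) (K : Type) [Field K] [NumberField K],
      kolyvagin N W K)
    (hMN : ∀ (N : ℕ) [NeZero N] (W : WeierstrassCurve ℚ) (K : Type) [Field K] [NumberField K],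
      MatarNekovar2019.thm03_padicValNat_card_sha_le_of_irreducible N W K)
    (hGZK : rank_eq_analyticRank_of_analyticRank_le_one) (hmod : hasEntireLFunction_rat)
    (hnf : exists_isNewformOf) (hFH : friedbergHoffstein_exists_heegnerField_split_twist_ne_zero)
    (hCM8 : bsdTriple_of_hasCM_of_L_one_ne_zero)
    (hEdx : edixhoven_not_dvd_maninConstant_of_not_potentiallyGoodOrdinary)
    (W : WeierstrassCurve ℚ) [W.IsElliptic] [W.IsGloballyMinimal] (p : ℕ) [Fact p.Prime]
    [NeZero (W.conductorNorm ℤ)]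
    (hX : ClassX12 W p) (hp7 : 7 < p) (hnr : ¬ CMRamified W p) (hns : ¬ CMSplit W p)
    (D : ModularParametrizationData W (W.conductorNorm ℤ))
    (hopt : ∀ z ∈ D.L.lattice, ∃ w ∈ periodLattice D.f, z = D.c * w) :
    MissingUpperBoundAt W p :=
  missingUpperBoundAt_of_classX12_of_cmInert_of_optimal hGZ hKo hMN hGZK hmod hnf hFH hCM8 hEdx
    deuring_not_hasUnitRootAt_of_hasCM_of_not_cmSplit_holds W p hX hp7 hnr hns D hopt

/-- **`hDeu`-free form of `bsdp_of_classX12_of_cmInert_of_optimal_of_lower`** — the same statement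
with the binder `(hDeu : deuring_not_hasUnitRootAt_of_hasCM_of_not_cmSplit)` REMOVED: Deuring's
criterion (supersingular half) is the tree theorem
`deuring_not_hasUnitRootAt_of_hasCM_of_not_cmSplit_holds` (p253190); proof = the original applied to
it. [cite: EdixhovenManin1991, Thm. 3] [cite: MatarNekovar2019, Thm. 0.3 and §0.11]
[cite: Lang1987, Ch. 13 §4 Thm. 12] -/
theorem bsdp_of_classX12_of_cmInert_of_optimal_of_lower'
    (hGZ : ∀ (N : ℕ) [NeZero N] (W : WeierstrassCurve ℚ) (K : Type) [Field K] [NumberField K],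
      gross_zagier N W K)
    (hKo : ∀ (N : ℕ) [NeZero N] (W : WeierstrassCurve ℚ) (K : Type) [Field K] [NumberField K],
      kolyvagin N W K)
    (hMN : ∀ (N : ℕ) [NeZero N] (W : WeierstrassCurve ℚ) (K : Type) [Field K] [NumberField K],
      MatarNekovar2019.thm03_padicValNat_card_sha_le_of_irreducible N W K)
    (hGZK : rank_eq_analyticRank_of_analyticRank_le_one) (hmod : hasEntireLFunction_rat)
    (hnf : exists_isNewformOf) (hFH : friedbergHoffstein_exists_heegnerField_split_twist_ne_zero)
    (hCM8 : bsdTriple_of_hasCM_of_L_one_ne_zero)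
    (hEdx : edixhoven_not_dvd_maninConstant_of_not_potentiallyGoodOrdinary)
    (W : WeierstrassCurve ℚ) [W.IsElliptic] [W.IsGloballyMinimal] (p : ℕ) [Fact p.Prime]
    [NeZero (W.conductorNorm ℤ)]
    (hX : ClassX12 W p) (hp7 : 7 < p) (hnr : ¬ CMRamified W p) (hns : ¬ CMSplit W p)
    (D : ModularParametrizationData W (W.conductorNorm ℤ))
    (hopt : ∀ z ∈ D.L.lattice, ∃ w ∈ periodLattice D.f, z = D.c * w)
    (hlow : MissingLowerBoundAt W p) : BSDp W p :=
  bsdp_of_classX12_of_cmInert_of_optimal_of_lower hGZ hKo hMN hGZK hmod hnf hFH hCM8 hEdx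
    deuring_not_hasUnitRootAt_of_hasCM_of_not_cmSplit_holds W p hX hp7 hnr hns D hopt hlow

/-- **`hDeu`-free form of `missingInputAt_of_classX12_of_cmInert_of_optimal_of_lower`** — the same
statement with the binder `(hDeu : deuring_not_hasUnitRootAt_of_hasCM_of_not_cmSplit)` REMOVED:
Deuring's criterion (supersingular half) is the tree theorem
`deuring_not_hasUnitRootAt_of_hasCM_of_not_cmSplit_holds` (p253190); proof = the original applied to
it. [cite: EdixhovenManin1991, Thm. 3] [cite: MatarNekovar2019, Thm. 0.3 and §0.11]
[cite: Lang1987, Ch. 13 §4 Thm. 12] -/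
theorem missingInputAt_of_classX12_of_cmInert_of_optimal_of_lower'
    (hGZ : ∀ (N : ℕ) [NeZero N] (W : WeierstrassCurve ℚ) (K : Type) [Field K] [NumberField K],
      gross_zagier N W K)
    (hKo : ∀ (N : ℕ) [NeZero N] (W : WeierstrassCurve ℚ) (K : Type) [Field K] [NumberField K],
      kolyvagin N W K)
    (hMN : ∀ (N : ℕ) [NeZero N] (W : WeierstrassCurve ℚ) (K : Type) [Field K] [NumberField K],
      MatarNekovar2019.thm03_padicValNat_card_sha_le_of_irreducible N W K)
    (hGZK : rank_eq_analyticRank_of_analyticRank_le_one) (hmod : hasEntireLFunction_rat)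
    (hnf : exists_isNewformOf) (hFH : friedbergHoffstein_exists_heegnerField_split_twist_ne_zero)
    (hCM8 : bsdTriple_of_hasCM_of_L_one_ne_zero)
    (hEdx : edixhoven_not_dvd_maninConstant_of_not_potentiallyGoodOrdinary)
    (W : WeierstrassCurve ℚ) [W.IsElliptic] [W.IsGloballyMinimal] (p : ℕ) [Fact p.Prime]
    [NeZero (W.conductorNorm ℤ)]
    (hX : ClassX12 W p) (hp7 : 7 < p) (hnr : ¬ CMRamified W p) (hns : ¬ CMSplit W p)
    (D : ModularParametrizationData W (W.conductorNorm ℤ))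
    (hopt : ∀ z ∈ D.L.lattice, ∃ w ∈ periodLattice D.f, z = D.c * w)
    (hlow : MissingLowerBoundAt W p) : X12.MissingInputAt W p :=
  missingInputAt_of_classX12_of_cmInert_of_optimal_of_lower hGZ hKo hMN hGZK hmod hnf hFH hCM8 hEdx
    deuring_not_hasUnitRootAt_of_hasCM_of_not_cmSplit_holds W p hX hp7 hnr hns D hopt hlow

/-- **`hDeu`-free form of `bsdp_iff_missingLowerBoundAt_of_classX12_of_cmInert_of_optimal`** — the
same statement with the binder `(hDeu : deuring_not_hasUnitRootAt_of_hasCM_of_not_cmSplit)` REMOVED: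
Deuring's criterion (supersingular half) is the tree theorem
`deuring_not_hasUnitRootAt_of_hasCM_of_not_cmSplit_holds` (p253190); proof = the original applied to
it. [cite: EdixhovenManin1991, Thm. 3] [cite: MatarNekovar2019, Thm. 0.3 and §0.11]
[cite: Lang1987, Ch. 13 §4 Thm. 12] -/
theorem bsdp_iff_missingLowerBoundAt_of_classX12_of_cmInert_of_optimal'
    (hGZ : ∀ (N : ℕ) [NeZero N] (W : WeierstrassCurve ℚ) (K : Type) [Field K] [NumberField K],
      gross_zagier N W K)
    (hKo : ∀ (N : ℕ) [NeZero N] (W : WeierstrassCurve ℚ) (K : Type) [Field K] [NumberField K],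
      kolyvagin N W K)
    (hMN : ∀ (N : ℕ) [NeZero N] (W : WeierstrassCurve ℚ) (K : Type) [Field K] [NumberField K],
      MatarNekovar2019.thm03_padicValNat_card_sha_le_of_irreducible N W K)
    (hGZK : rank_eq_analyticRank_of_analyticRank_le_one) (hmod : hasEntireLFunction_rat)
    (hnf : exists_isNewformOf) (hFH : friedbergHoffstein_exists_heegnerField_split_twist_ne_zero)
    (hCM8 : bsdTriple_of_hasCM_of_L_one_ne_zero)
    (hEdx : edixhoven_not_dvd_maninConstant_of_not_potentiallyGoodOrdinary)
    (W : WeierstrassCurve ℚ) [W.IsElliptic] [W.IsGloballyMinimal] (p : ℕ) [Fact p.Prime]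
    [NeZero (W.conductorNorm ℤ)]
    (hX : ClassX12 W p) (hp7 : 7 < p) (hnr : ¬ CMRamified W p) (hns : ¬ CMSplit W p)
    (D : ModularParametrizationData W (W.conductorNorm ℤ))
    (hopt : ∀ z ∈ D.L.lattice, ∃ w ∈ periodLattice D.f, z = D.c * w) :
    BSDp W p ↔ MissingLowerBoundAt W p :=
  bsdp_iff_missingLowerBoundAt_of_classX12_of_cmInert_of_optimal hGZ hKo hMN hGZK hmod hnf hFH hCM8
    hEdx deuring_not_hasUnitRootAt_of_hasCM_of_not_cmSplit_holds W p hX hp7 hnr hns D hopt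

/-- **`hDeu`-free form of `bsdp_iff_forall_indexLowerBoundAt_of_classX12_of_cmInert_of_optimal`** —
the same statement with the binder `(hDeu : deuring_not_hasUnitRootAt_of_hasCM_of_not_cmSplit)`
REMOVED: Deuring's criterion (supersingular half) is the tree theorem
`deuring_not_hasUnitRootAt_of_hasCM_of_not_cmSplit_holds` (p253190); proof = the original applied to
it. [cite: EdixhovenManin1991, Thm. 3] [cite: MatarNekovar2019, Thm. 0.3, Thm. 0.7 and §0.11]
[cite: JetchevSkinnerWan2017, §7.4.1 (eq. shalowerK-1)] [cite: Lang1987, Ch. 13 §4 Thm. 12] -/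
theorem bsdp_iff_forall_indexLowerBoundAt_of_classX12_of_cmInert_of_optimal'
    (hGZ : ∀ (N : ℕ) [NeZero N] (W : WeierstrassCurve ℚ) (K : Type) [Field K] [NumberField K],
      gross_zagier N W K)
    (hKo : ∀ (N : ℕ) [NeZero N] (W : WeierstrassCurve ℚ) (K : Type) [Field K] [NumberField K],
      kolyvagin N W K)
    (hMN : ∀ (N : ℕ) [NeZero N] (W : WeierstrassCurve ℚ) (K : Type) [Field K] [NumberField K],
      MatarNekovar2019.thm03_padicValNat_card_sha_le_of_irreducible N W K)
    (hGZK : rank_eq_analyticRank_of_analyticRank_le_one) (hmod : hasEntireLFunction_rat)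
    (hnf : exists_isNewformOf) (hFH : friedbergHoffstein_exists_heegnerField_split_twist_ne_zero)
    (hCM8 : bsdTriple_of_hasCM_of_L_one_ne_zero)
    (hEdx : edixhoven_not_dvd_maninConstant_of_not_potentiallyGoodOrdinary)
    (W : WeierstrassCurve ℚ) [W.IsElliptic] [W.IsGloballyMinimal] (p : ℕ) [Fact p.Prime]
    [NeZero (W.conductorNorm ℤ)]
    (hX : ClassX12 W p) (hp7 : 7 < p) (hnr : ¬ CMRamified W p) (hns : ¬ CMSplit W p)
    (D : ModularParametrizationData W (W.conductorNorm ℤ))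
    (hopt : ∀ z ∈ D.L.lattice, ∃ w ∈ periodLattice D.f, z = D.c * w) :
    BSDp W p ↔
      ∀ (K : Type) [Field K] [NumberField K]
        (H : HeegnerDatum (W.conductorNorm ℤ) (NumberField.discr K)) (ι : K →+* ℂ)
        (P : (W.baseChange K).toAffine.Point),
        IsImaginaryQuadratic K → SatisfiesHeegnerHypothesis (W.conductorNorm ℤ) K →
        4 < (NumberField.discr K).natAbs →
        WeierstrassCurve.Affine.Point.map ι.toRatAlgHom P = heegnerPointComplex D H →
        (W.quadraticTwist (NumberField.discr K : ℚ)).entireLFunction 1 ≠ 0 →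
        (Finite (W.baseChange K).sha → X11b.IndexLowerBoundAt W p K P) :=
  bsdp_iff_forall_indexLowerBoundAt_of_classX12_of_cmInert_of_optimal hGZ hKo hMN hGZK hmod hnf hFH
    hCM8 hEdx deuring_not_hasUnitRootAt_of_hasCM_of_not_cmSplit_holds W p hX hp7 hnr hns D hopt

/-- **`hDeu`-free form of `bsdp_of_isIsogenous_of_classX12_of_cmInert_of_optimal_of_lower`** — the
same statement with the binder `(hDeu : deuring_not_hasUnitRootAt_of_hasCM_of_not_cmSplit)` REMOVED:
Deuring's criterion (supersingular half) is the tree theorem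
`deuring_not_hasUnitRootAt_of_hasCM_of_not_cmSplit_holds` (p253190); proof = the original applied to
it. [cite: Cassels1965ArithmeticVIII] [cite: MilneADT2006, Thm. I.7.3 and Remark I.7.4]
[cite: EdixhovenManin1991, Thm. 3] [cite: MatarNekovar2019, Thm. 0.3 and §0.11]
[cite: Lang1987, Ch. 13 §4 Thm. 12] -/
theorem bsdp_of_isIsogenous_of_classX12_of_cmInert_of_optimal_of_lower'
    (hGZ : ∀ (N : ℕ) [NeZero N] (W : WeierstrassCurve ℚ) (K : Type) [Field K] [NumberField K],
      gross_zagier N W K)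
    (hKo : ∀ (N : ℕ) [NeZero N] (W : WeierstrassCurve ℚ) (K : Type) [Field K] [NumberField K],
      kolyvagin N W K)
    (hMN : ∀ (N : ℕ) [NeZero N] (W : WeierstrassCurve ℚ) (K : Type) [Field K] [NumberField K],
      MatarNekovar2019.thm03_padicValNat_card_sha_le_of_irreducible N W K)
    (hGZK : rank_eq_analyticRank_of_analyticRank_le_one) (hmod : hasEntireLFunction_rat)
    (hnf : exists_isNewformOf) (hFH : friedbergHoffstein_exists_heegnerField_split_twist_ne_zero)
    (hCM8 : bsdTriple_of_hasCM_of_L_one_ne_zero)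
    (hEdx : edixhoven_not_dvd_maninConstant_of_not_potentiallyGoodOrdinary)
    (hCassels : bsdRHS_eq_of_isIsogenous)
    {W W₀ : WeierstrassCurve ℚ} [W.IsElliptic] [W₀.IsElliptic] [W.IsGloballyMinimal]
    [W₀.IsGloballyMinimal] (p : ℕ) [Fact p.Prime] [NeZero (W₀.conductorNorm ℤ)]
    (hiso : IsIsogenous W W₀) (hX : ClassX12 W₀ p) (hp7 : 7 < p) (hnr : ¬ CMRamified W₀ p)
    (hns : ¬ CMSplit W₀ p) (D₀ : ModularParametrizationData W₀ (W₀.conductorNorm ℤ))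
    (hopt : ∀ z ∈ D₀.L.lattice, ∃ w ∈ periodLattice D₀.f, z = D₀.c * w)
    (hlow : MissingLowerBoundAt W₀ p) : BSDp W p :=
  bsdp_of_isIsogenous_of_classX12_of_cmInert_of_optimal_of_lower hGZ hKo hMN hGZK hmod hnf hFH hCM8
    hEdx deuring_not_hasUnitRootAt_of_hasCM_of_not_cmSplit_holds hCassels p hiso hX hp7 hnr hns D₀
    hopt hlow

end Summit.BirchSwinnertonDyer.Rank1Residual.X12

end
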